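import Mathlib
import HarnessLib
import Literature.Analysis.FluidPDE.VectorCalculus
import Literature.Analysis.FluidPDE.AxisymmetricVorticityTransport
import Summits.NavierStokesRegularity.NavierStokesRegularity.Theorems.UnthreadedDoorAntidynamoEvenRungNormalForm
import Summits.NavierStokesRegularity.NavierStokesRegularity.Theorems.UnthreadedDoorAntidynamoEvenRungSliceIdentity
import Summits.NavierStokesRegularity.NavierStokesRegularity.Theorems.UnthreadedDoorAntidynamoSingleDegreeRungZonal
import Summits.NavierStokesRegularity.NavierStokesRegularity.Theorems.UnthreadedDoorAntidynamoSingleDegreeRungOdd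
import Summits.NavierStokesRegularity.NavierStokesRegularity.Theorems.UnthreadedDoorAntidynamoSingleDegreeRungOfCrux

/-!
# Route `UnthreadedDoor` / `ThreadingFlux`, crux `PoloidalLiouville` (stmt-NavierStokesRegularity-1222), antidynamo v2 skeleton
# (sha16 `4ebf5683127b`): ★★★ THE RUNG `stub_singleDegreeRung` IS A THEOREM — the EVEN degree closed by the (E1) assembly, the odd
# degree by parity (p798877); `theorem stub_singleDegreeRung : StubSingleDegreeRung` BY NAME AND SIGNATURE

Closing file for the registered stub `stub_singleDegreeRung` of crux 1222 (census instrument decomp-ns-census-1 g34, cell decomp-ns;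
`--supports stmt-NavierStokesRegularity-1222`; 0 kit).  THE (E1) ASSEMBLY PROPER, all inputs tree theorems:

* `exists_rayAmplitude` — under the rung's verbatim hypotheses (`P ≠ 0`) the vorticity amplitude READ ALONG A RAY,
  `Φ(s, r) := ⟪curl (v s)(x₀ + rξ), Λξ⟫ / (r^l ‖Λξ‖²)` (`Λ = ∇P × id`, `ξ` a unit vector with `Λξ ≠ 0`, p811643), is JOINTLY SMOOTH on
  `(−∞,0) × (0,∞)` (joint smoothness of the vorticity of the class, `IsSmoothSpaceTimeOn.isSmoothSpaceTimeOn_vorticity`), REPRESENTS the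
  vorticity off the centre at every slice (uniqueness of the amplitude against S2, p797227) and obeys `|Φ(s, r)|·r^l ≤ K/‖Λξ‖` for ALL `r > 0`
  (bounded vorticity of the class, p629171);
* ★★ `singleDegreeRung_even` — the rung for EVEN `l`: at each slice, `evenRung_normalForm` (p814140: constant, or the kinematic normal form
  `v t(x₀ + y) = (aP)•y + k•∇P` with hG/hdiv) then `evenRung_sliceIdentity` (E1d: the vorticity equation IS `hid` with explicit `c, e`) feed
  `evenRung_slice_const_of_rung` (p811987: (E1) data ⟹ constant slice, every profile; inside: p810874 separation, p810995 ODE branch, p809884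
  zonal lemma, cell-flux Z/KNSS for the zonal quadratic);
* ★★★ `stub_singleDegreeRung : StubSingleDegreeRung` — VERBATIM the registered stub (skeleton l. 152; twin in `…SingleDegreeRungOfCrux`):
  even `l` by `singleDegreeRung_even`, odd `l` by `singleDegreeRung_odd` (p798877).

HONEST LABEL: this CLOSES the BC5 rung of the antidynamo line — a bounded ancient mild solution whose slices are single-degree toroidal fields
plus gradients has constant slices — UNCONDITIONALLY.  It does NOT touch the WALL `stub_scalarLiouville` (XL, open in print beyond axisymmetry),
hence not `PoloidalLiouville` (1222), and nothing here bears on Navier–Stokes regularity (crux 1222 is INCOMPARABLE with the summit; the rung is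
descent inside the door's cone, decorative for the summit).  Nothing here proves NavierStokesRegularity. [folklore]
-/

noncomputable section

-- the summit and its single sub-problem share the name (CONVENTIONS §1), as in every Theorems file
set_option linter.dupNamespace false

open scoped Topology InnerProductSpace RealInnerProductSpace ContDiff Laplacian
open Filter Set Metric MeasureTheory MvPolynomial Function
open Literature.Analysis.FluidPDE

namespace Summit.NavierStokesRegularity.NavierStokesRegularity.Theorems.PoloidalLiouville.Antidynamo

open Summit.NavierStokesRegularity.NavierStokesRegularity.Theorems.PoloidalLiouville (exists_norm_curl_le)
open Summit.NavierStokesRegularity.NavierStokesRegularity.Theorems.PoloidalLiouville.HorizonTower (inner_gradient_self_of_homogeneous_nat)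

/-! ### The amplitude along a ray -/

/-- **THE VORTICITY AMPLITUDE READ ALONG A RAY.**  Under the rung's verbatim hypotheses with `P ≠ 0` there is `Φ : ℝ → ℝ → ℝ`, jointly smooth
on `(−∞,0) × (0,∞)`, with `curl (v s) x = Φ(s, ‖x − x₀‖)•(∇P(x − x₀) × (x − x₀))` for every `s < 0`, `x ≠ x₀`, and `|Φ(s, r)|·r^l ≤ K` for all
`s < 0`, `r > 0`. [folklore] -/
theorem exists_rayAmplitude
    (v : ℝ → EuclideanSpace ℝ (Fin 3) → EuclideanSpace ℝ (Fin 3)) (x₀ : EuclideanSpace ℝ (Fin 3))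
    (hB : Literature.Analysis.FluidPDE.IsBoundedAncientMildSolution 1 v)
    (hm : ∀ t < 0, AEStronglyMeasurable (v t) volume)
    (hsm : ContDiffOn ℝ (⊤ : ℕ∞) (Function.uncurry v) (Set.Iio 0 ×ˢ Set.univ))
    {l : ℕ} {P : MvPolynomial (Fin 3) ℝ} (hl : 2 ≤ l) (hP : P.IsHomogeneous l) (hP0 : P ≠ 0)
    (hharm : ∀ y : EuclideanSpace ℝ (Fin 3),
      Laplacian.laplacian (fun z : EuclideanSpace ℝ (Fin 3) => MvPolynomial.eval (fun i => z i) P) y = 0)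
    (hrep : ∀ t < 0, ∃ (g : ℝ → ℝ) (φ : EuclideanSpace ℝ (Fin 3) → ℝ), ∀ x,
      v t x = gradient φ x + (g ‖x - x₀‖ * MvPolynomial.eval (fun i => (x - x₀) i) P) • (x - x₀)) :
    ∃ Φ : ℝ → ℝ → ℝ, ContDiffOn ℝ ∞ (Function.uncurry Φ) (Iio 0 ×ˢ Ioi 0) ∧
      (∀ s < 0, ∀ x : EuclideanSpace ℝ (Fin 3), x ≠ x₀ →
        curl (v s) x = Φ s ‖x - x₀‖ •
          cross (gradient (fun z : EuclideanSpace ℝ (Fin 3) => MvPolynomial.eval (fun i => z i) P) (x - x₀)) (x - x₀)) ∧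
      ∃ K : ℝ, ∀ s < 0, ∀ r, 0 < r → |Φ s r| * r ^ l ≤ K := by
  -- the profile and a good direction
  have hQω : ContDiff ℝ ω (fun z : EuclideanSpace ℝ (Fin 3) => MvPolynomial.eval (fun i => z i) P) := contDiff_omega_evalPoly P
  have hQhom : ∀ r : ℝ, 0 < r → ∀ y : EuclideanSpace ℝ (Fin 3),
      (fun z : EuclideanSpace ℝ (Fin 3) => MvPolynomial.eval (fun i => z i) P) (r • y) =
        r ^ l * (fun z : EuclideanSpace ℝ (Fin 3) => MvPolynomial.eval (fun i => z i) P) y :=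
    fun r _ y => evalPoly_smul hP r y
  have hQne : ∃ y, (fun z : EuclideanSpace ℝ (Fin 3) => MvPolynomial.eval (fun i => z i) P) y ≠ 0 := exists_evalPoly_ne_zero hP0
  obtain ⟨ξ, hξ1, hξ⟩ := exists_unit_cross_gradient_ne_zero hQω (by omega) hQhom hharm hQne
  set Λ : EuclideanSpace ℝ (Fin 3) → EuclideanSpace ℝ (Fin 3) :=
    fun y => cross (gradient (fun z : EuclideanSpace ℝ (Fin 3) => MvPolynomial.eval (fun i => z i) P) y) y with hΛ
  have hΛhom : ∀ r : ℝ, 0 < r → ∀ y : EuclideanSpace ℝ (Fin 3), Λ (r • y) = r ^ l • Λ y :=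
    fun r hr y => cross_gradient_smul_of_homogeneous (hQω.differentiable (by simp)) hQhom hr y
  have hΛξ : 0 < ‖Λ ξ‖ := norm_pos_iff.mpr hξ
  have hξ0 : ξ ≠ 0 := by
    intro h; rw [h, norm_zero] at hξ1; exact zero_ne_one hξ1
  -- the amplitude
  set Φ : ℝ → ℝ → ℝ := fun s r => ⟪curl (v s) (x₀ + r • ξ), Λ ξ⟫ / (r ^ l * ‖Λ ξ‖ ^ 2) with hΦ
  obtain ⟨K, hK⟩ := exists_norm_curl_le hB hsm
  refine ⟨Φ, ?_, ?_, K / ‖Λ ξ‖, ?_⟩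
  · -- joint smoothness
    have hsm' : IsSmoothSpaceTimeOn (Iio 0) v := hsm
    have hω : IsSmoothSpaceTimeOn (Iio 0) (vorticity v) := hsm'.isSmoothSpaceTimeOn_vorticity (uniqueDiffOn_Iio 0)
    have hg : ContDiff ℝ ∞ (fun p : ℝ × ℝ => ((p.1, x₀ + p.2 • ξ) : ℝ × EuclideanSpace ℝ (Fin 3))) :=
      contDiff_fst.prodMk (contDiff_const.add (contDiff_snd.smul contDiff_const))
    have hcomp : ContDiffOn ℝ ∞ (fun p : ℝ × ℝ => uncurry (vorticity v) (p.1, x₀ + p.2 • ξ)) (Iio 0 ×ˢ Ioi 0) :=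
      hω.comp hg.contDiffOn fun p hp => mk_mem_prod hp.1 (mem_univ _)
    have hnum : ContDiffOn ℝ ∞ (fun p : ℝ × ℝ => ⟪uncurry (vorticity v) (p.1, x₀ + p.2 • ξ), Λ ξ⟫) (Iio 0 ×ˢ Ioi 0) :=
      hcomp.inner ℝ contDiffOn_const
    have hden : ContDiffOn ℝ ∞ (fun p : ℝ × ℝ => p.2 ^ l * ‖Λ ξ‖ ^ 2) (Iio 0 ×ˢ Ioi 0) :=
      (contDiffOn_snd.pow l).mul contDiffOn_const
    have h := hnum.div hden fun p hp => mul_ne_zero (pow_ne_zero _ (ne_of_gt hp.2)) (pow_ne_zero _ hΛξ.ne')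
    refine h.congr fun p _ => ?_
    rfl
  · -- representation at every slice (uniqueness against S2)
    intro s hs x hx
    obtain ⟨ĝ, -, hcurl⟩ := singleDegree_vorticity_structure v x₀ hB hm hsm hl hP hP0 hharm hrep s hs
    have hr : 0 < ‖x - x₀‖ := norm_pos_iff.mpr (sub_ne_zero.mpr hx)
    -- read the S2 representation along the ray at radius `‖x − x₀‖`
    have hray : Φ s ‖x - x₀‖ = ĝ ‖x - x₀‖ := by
      set r := ‖x - x₀‖ with hrdef
      have hn : ‖r • ξ‖ = r := by rw [norm_smul, Real.norm_eq_abs, abs_of_pos hr, hξ1, mul_one]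
      have hne : x₀ + r • ξ ≠ x₀ := fun h => (smul_ne_zero hr.ne' hξ0) (by simpa using h)
      have h1 := hcurl _ hne
      rw [add_sub_cancel_left, hn] at h1
      -- `h1 : curl (v s) (x₀ + r • ξ) = ĝ r • Λ (r • ξ)`
      have h2 : ⟪curl (v s) (x₀ + r • ξ), Λ ξ⟫ = ĝ r * (r ^ l * ‖Λ ξ‖ ^ 2) := by
        rw [h1, show cross (gradient (fun z : EuclideanSpace ℝ (Fin 3) => MvPolynomial.eval (fun i => z i) P) (r • ξ)) (r • ξ)
          = Λ (r • ξ) from rfl, hΛhom r hr ξ, smul_smul, real_inner_smul_left, real_inner_self_eq_norm_sq]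
        ring
      rw [hΦ]
      dsimp only
      rw [h2, mul_div_assoc, div_self (mul_ne_zero (pow_ne_zero _ hr.ne') (pow_ne_zero _ hΛξ.ne')), mul_one]
    rw [hray]
    exact hcurl x hx
  · -- the bound from bounded vorticity
    intro s hs r hr
    have h1 : |⟪curl (v s) (x₀ + r • ξ), Λ ξ⟫| ≤ K * ‖Λ ξ‖ :=
      (abs_real_inner_le_norm _ _).trans (mul_le_mul_of_nonneg_right (hK s hs _) (norm_nonneg _))
    have hrl : 0 < r ^ l := pow_pos hr _
    rw [hΦ]
    dsimp only
    rw [abs_div, abs_of_pos (mul_pos hrl (pow_pos hΛξ 2)), div_mul_eq_mul_div, le_div_iff₀ hΛξ,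
      div_mul_eq_mul_div, div_le_iff₀ (mul_pos hrl (pow_pos hΛξ 2))]
    calc |⟪curl (v s) (x₀ + r • ξ), Λ ξ⟫| * r ^ l * ‖Λ ξ‖ = |⟪curl (v s) (x₀ + r • ξ), Λ ξ⟫| * (r ^ l * ‖Λ ξ‖) := by ring
      _ ≤ (K * ‖Λ ξ‖) * (r ^ l * ‖Λ ξ‖) := mul_le_mul_of_nonneg_right h1 (by positivity)
      _ = K * (r ^ l * ‖Λ ξ‖ ^ 2) := by ring

/-! ### ★★ The even rung -/

/-- ★★ **THE SINGLE-DEGREE RUNG IN EVEN DEGREE.**  `StubSingleDegreeRung`'s hypotheses with the extra conjunct `Even l` imply constant slices: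
`P = 0` is the gradient branch; otherwise, at each slice, the normal form (p814140) and the slice identity (E1d) supply the (E1) data, and
`evenRung_slice_const_of_rung` (p811987) concludes. [folklore] -/
theorem singleDegreeRung_even
    (v : ℝ → EuclideanSpace ℝ (Fin 3) → EuclideanSpace ℝ (Fin 3)) (x₀ : EuclideanSpace ℝ (Fin 3))
    (hB : Literature.Analysis.FluidPDE.IsBoundedAncientMildSolution 1 v)
    (hm : ∀ t < 0, AEStronglyMeasurable (v t) volume)
    (hsm : ContDiffOn ℝ (⊤ : ℕ∞) (Function.uncurry v) (Set.Iio 0 ×ˢ Set.univ))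
    (hform : ∃ (l : ℕ) (P : MvPolynomial (Fin 3) ℝ), 2 ≤ l ∧ Even l ∧ P.IsHomogeneous l ∧
      (∀ y : EuclideanSpace ℝ (Fin 3),
        Laplacian.laplacian (fun z : EuclideanSpace ℝ (Fin 3) => MvPolynomial.eval (fun i => z i) P) y = 0) ∧
      ∀ t < 0, ∃ (g : ℝ → ℝ) (φ : EuclideanSpace ℝ (Fin 3) → ℝ), ∀ x,
        v t x = gradient φ x + (g ‖x - x₀‖ * MvPolynomial.eval (fun i => (x - x₀) i) P) • (x - x₀)) :
    ∀ t < 0, ∃ b : EuclideanSpace ℝ (Fin 3), ∀ x, v t x = b := by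
  obtain ⟨l, P, hl, hev, hP, hharm, hrep⟩ := hform
  by_cases hP0 : P = 0
  · -- the gradient branch
    refine constant_of_forall_gradient_slices v hB hsm fun t ht => ?_
    obtain ⟨g, φ, hv⟩ := hrep t ht
    exact ⟨φ, fun x => by rw [hv x, hP0, map_zero, mul_zero, zero_smul, add_zero]⟩
  -- the profile's calculus
  have hQω : ContDiff ℝ ω (fun z : EuclideanSpace ℝ (Fin 3) => MvPolynomial.eval (fun i => z i) P) := contDiff_omega_evalPoly P
  have hQs : ContDiff ℝ ∞ (fun z : EuclideanSpace ℝ (Fin 3) => MvPolynomial.eval (fun i => z i) P) := hQω.of_le le_top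
  have hQhom : ∀ r : ℝ, 0 < r → ∀ y : EuclideanSpace ℝ (Fin 3),
      (fun z : EuclideanSpace ℝ (Fin 3) => MvPolynomial.eval (fun i => z i) P) (r • y) =
        r ^ l * (fun z : EuclideanSpace ℝ (Fin 3) => MvPolynomial.eval (fun i => z i) P) y :=
    fun r _ y => evalPoly_smul hP r y
  have hEuler : ∀ z : EuclideanSpace ℝ (Fin 3),
      ⟪gradient (fun w : EuclideanSpace ℝ (Fin 3) => MvPolynomial.eval (fun i => w i) P) z, z⟫ =
        (l : ℝ) * (fun w : EuclideanSpace ℝ (Fin 3) => MvPolynomial.eval (fun i => w i) P) z := fun z =>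
    inner_gradient_self_of_homogeneous_nat ((hQω.differentiable (by simp)) z) fun c y => evalPoly_smul hP c y
  -- the amplitude along a ray
  obtain ⟨Φ, hΦ, hrepr, K, hK⟩ := exists_rayAmplitude v x₀ hB hm hsm hl hP hP0 hharm hrep
  intro t ht
  have hĝs : ContDiffOn ℝ ∞ (Φ t) (Ioi 0) :=
    hΦ.comp (contDiffOn_const.prodMk contDiffOn_id) fun r hr => mk_mem_prod ht hr
  have hdA : ∀ {f : ℝ → ℝ}, ContDiffOn ℝ ∞ f (Ioi 0) → ∀ r, 0 < r → DifferentiableAt ℝ f r := fun hf r hr =>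
    (hf.differentiableOn (by simp)).differentiableAt (Ioi_mem_nhds hr)
  -- the kinematic normal form
  rcases evenRung_normalForm v x₀ hB hm hsm hl hev hP hP0 hharm hrep ht hĝs (hK t ht) (hrepr t ht) with hconst | ⟨a, k, ha, hk, hG, hdiv, hnf⟩
  · exact hconst
  -- the slice identity
  obtain ⟨c, e, hc, he, hid⟩ := evenRung_sliceIdentity v x₀ hB hm hsm hQs hQhom hEuler hharm hΦ hrepr ht ha hk hnf
  -- the (E1) data close the slice
  exact evenRung_slice_const_of_rung v x₀ hB hm hsm hl hP hP0 hharm hrep ht (hrepr t ht) (hdA ha) (hdA hk) hc he hG hdiv hid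

/-! ### ★★★ The registered stub, by name and signature -/

/-- ★★★ **`stub_singleDegreeRung : StubSingleDegreeRung`** — the BC5 rung of the antidynamo v2 skeleton of crux `PoloidalLiouville`
(stmt-NavierStokesRegularity-1222), VERBATIM (skeleton l. 152): a bounded ancient mild solution (`ν = 1`, duality class) with measurable slices,
jointly smooth on `(−∞,0) × ℝ³`, whose every slice has the single-degree form `v t x = ∇φ(x) + (g(‖x − x₀‖)·P(x − x₀))•(x − x₀)` for a solid
harmonic `P` of degree `l ≥ 2`, has constant slices.  Even `l`: `singleDegreeRung_even`; odd `l`: `singleDegreeRung_odd` (p798877).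
UNCONDITIONAL; the wall `stub_scalarLiouville` and the crux remain OPEN. [folklore] -/
theorem stub_singleDegreeRung : StubSingleDegreeRung := by
  intro v x₀ hB hm hsm hform
  obtain ⟨l, P, hl, hP, hharm, hrep⟩ := hform
  rcases Nat.even_or_odd l with hev | hodd
  · exact singleDegreeRung_even v x₀ hB hm hsm ⟨l, P, hl, hev, hP, hharm, hrep⟩
  · exact singleDegreeRung_odd v x₀ hB hm hsm ⟨l, P, hl, hodd, hP, hharm, hrep⟩

end Summit.NavierStokesRegularity.NavierStokesRegularity.Theorems.PoloidalLiouville.Antidynamo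

end
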